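import Literature.NumberTheory.EllipticCurves.Castella2018.ErratumThm23UpperDivisibilitySelfDual
import HarnessLib

/-!
# Castella's erratum, Theorem 2.3, the «⊂» half (2.5) ON THE SELF-DUAL TATE TWIST, WITH HYPOTHESES (i) AND (iii) AS PRINTED
# (flag `T23-footnote` RETIRED): `ρ̄_g|_{G_K}` irreducible, and a prime `q ∥ M` non-split in `K` — no residual ramification at `q`

Cell `bsd-stepL`, seat `bsd-stepL-imc-p1` g26 (2026-08-28; memo `run/shared/lean/pub/bsd-stepL/imc-p1/g26/RAMFREE-ROAD-imc-p1-g26.md`,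
evidence on items stmt-BirchSwinnertonDyer-19061 ∕ 23253). ONE new OPEN claim-tagged `Prop` (D-0014: +1 unproved): the transcription of
the erratum's Thm. 2.3 «⊂» half that the K2 crux is meant to carry on the WHOLE `ρ̄`-onto locus, not only on its (ram) part. It discharges
the `TODO(general form)` of F4♯ ∕ F4♯† («(i) as printed is "ρ̄_g|_{G_K} irreducible"»). F4♯† (`…_selfDual_OPEN`, imc-p1 g24) is left
untouched for its consumers of record (crux 23253, Road FF p658652-chain).

## What changes with respect to F4♯†, and why

F4♯ ∕ F4♯† transcribe hypothesis (i) of the erratum's Thm. 2.3 through the SUFFICIENT CONDITION of its footnote 1 — «the hypothesis that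
`ρ̄_{g_m} ≃ E[p]` is irreducible as a `G_ℚ`-module and ramified at some prime `q ∥ N` nonsplit in `K` implies that `ρ̄_{g_m}|_{G_K}` is
irreducible, see [Ski20, Lem. 2.8.1]» — i.e. as (i′) «`ρ̄_g` irreducible AND ramified at some `q ∥ M` non-split in `K`» (flag
`T23-footnote`). That is a STRONGER hypothesis, hence a WEAKER statement than print, and it is the ONLY place where residual ramification
at `q` enters the «⊂» chain: the erratum's (i) is VERBATIM «`ρ̄_g|_{G_K}` is irreducible» (p. 3), [FW21, Thm. 4.41]'s first bullet is
«`ρ̄_f|G_𝒦` is absolutely irreducible» and its third «there exists `q ∥ N` (in particular `q ∤ p`) which is not split in `𝒦`» — NO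
ramification of `ρ̄` at `q` (arXiv:2107.13726 p. 44); [Hsi14, Thm. B] (µ = 0) and [JSW17, Cor. 3.4.2] ((irred_K)) ask irreducibility
over `K` only; Hida theory (a)(b) [Ski16, §2.6 «Suppose that `ρ̄_f` is irreducible»] and [Cas20, Thm. 2.11] (standing: (heeg), `p > 2`
split, `d_K` odd) ask no ramification at `q` either; Castella himself (erratum p. 1, Remarks): these hypotheses «are not intrinsically
needed for the argument presented here, but rather inherited from (the final versions of) the results quoted». On the cell's locus
(`ρ̄_{E,p}` ONTO `GL₂(𝔽_p)`, `p ≥ 5`) hypothesis (i) holds for EVERY quadratic `K` (the image of `G_K` has index `≤ 2`, so contains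
`SL₂(𝔽_p) = [GL₂(𝔽_p), GL₂(𝔽_p)]`, which acts irreducibly) — whether or not `E[p]` is ramified at the non-split multiplicative prime
`q`. So this file states (2.5) with

* (i)  `IsSimpleOrder (Subrepresentation ((residualRep Δ).comp (absGaloisRestrict ℚ K)))` — `ρ̄_g|_{G_K}` irreducible, the restriction
  taken along the tree's `absGaloisRestrict ℚ K` exactly as in `Δ.selfDualCofreeRepOver K` ∕ `Δ.cofreeRepOver K`;
* (iii) `∃ q` prime, `q ∣ M`, `q² ∤ M`, `q` non-split in `K` — as printed;

every other binder BYTE-IDENTICAL with F4♯† (flags `T23-compat`, `T23-p`, `T23-receptacle`, `T23-frame-∀`, `T23-sigma-interp`,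
`T23-torsion-premise`, `T23-one-sided`, `T23-top`, `T23-twist` as documented in `ErratumThm23UpperDivisibilitySelfDual.lean` and
`ErratumThm23UpperDivisibility.lean`). Since (i′) ⟹ (i) ([Ski20, Lem. 2.8.1]) and (i′) ⟹ (iii), this `Prop` IMPLIES F4♯† (the
implication itself needs [Ski20, Lem. 2.8.1], i.e. the Steinberg shape of `ρ_g` at `q ∥ M` — not claimed here).
NB «absolutely irreducible» in [FW21] vs «irreducible» in the erratum: this file follows the erratum (the [claim] is on its Thm. 2.3);
on the `ρ̄`-onto locus both hold.
STATUS: **OPEN ∕ PRE** exactly as F4♯ ∕ F4♯† (rests on [FouquetWan2021, Thm. 4.41] + App. B Cor. 7.21 ∕ L. 7.22, the weight-`k`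
analogue of [CGS25 Prop. 2.4.5], [JSW17 Cor. 3.4.2], [Hsi14 Thm. B]; the erratum is unrefereed). NEVER cite this `Prop` as a theorem.

## References

* [Castella2018Erratum] §2 (p. 2), Thm. 2.3 (i)–(iv) (p. 3), (2.4)–(2.5), footnote 1 (p. 4), Remarks (pp. 1–2).
* [FouquetWan2021] Thm. 4.41 (arXiv:2107.13726 pp. 44–45, PREPRINT). [Skinner2020] Lem. 2.8.1. [Hsieh2014] Thm. B.
* [JetchevSkinnerWan2017] Cor. 3.4.2, §5.1. [Skinner2016PacificMC] §2.6. [Castella2020JIMJ] §2.5, Thm. 2.11.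
  Tree: `ErratumThm23UpperDivisibilitySelfDual.lean` (F4♯†), `OrdinaryNewformDatumSelfDualTwist.lean`,
  `SkinnerUrban2014/GL2MainConjecture.lean` (`residualRep`, `IsResiduallyIrreducible`), `GaloisRepresentations/AbsGaloisGroup.lean`.
-/

noncomputable section

open scoped Classical

namespace Literature.NumberTheory.EllipticCurves.Castella2018

open PowerSeries NumberField IsDedekindDomain Field
  Literature.NumberTheory.EllipticCurves Literature.NumberTheory.EllipticCurves.ModularForms
  Literature.NumberTheory.EllipticCurves.BigGaloisRep Literature.NumberTheory.EllipticCurves.GreenbergSelmer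
  Literature.NumberTheory.GaloisRepresentations

/-- **OPEN HYPOTHESIS — Castella's erratum, Thm. 2.3, the «⊂» half (2.5), Σ-imprimitive, for ONE `p`-ordinary crystalline newform
`g ∈ S_k(Γ₀(M))` over `K`, ON THE SELF-DUAL TATE TWIST `A_g = V_g^†/T_g^†`, read in `𝓞_{ℂ_p}⟦T⟧:
`Ch_{Λ_𝒪}(X^Σ_ac(A_g))·𝓞_{ℂ_p}⟦T⟧ ⊆ (L^Σ_p(g))` for every Σ-imprimitive frame `L^Σ_p(g) = Q` of `g`, under the torsion premise,
WITH HYPOTHESES (i) «`ρ̄_g|_{G_K}` irreducible» AND (iii) «some `q ∥ M` is non-split in `K`» AS PRINTED** — the erratum's use of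
[FW21, Thm. 4.41] (UNREFEREED), isolated from the member package. BYTE-IDENTICAL with
`erratumThm23_charIdeal_sigma_le_of_isTorsion_selfDual_OPEN` (F4♯†: self-dual module `Δ.selfDualCofreeRepOver K`, binders,
transcription and flags `T23-compat`, `T23-p`, `T23-receptacle`, `T23-frame-∀`, `T23-sigma-interp`, `T23-torsion-premise`,
`T23-one-sided`, `T23-top`, `T23-twist` as in that file's module docstring) EXCEPT for the two binders that F4♯ ∕ F4♯† spelled
through the sufficient condition of the erratum's footnote 1 (flag `T23-footnote`: «`ρ̄_g` irreducible and RAMIFIED at some `q ∥ M`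
non-split in `K`»), here replaced by the printed ones: (i) the reduction `ρ̄ = ρ mod ϖ` of the datum (`SkinnerUrban2014.residualRep`)
restricted along the tree's `absGaloisRestrict ℚ K` has exactly two subrepresentations (erratum Thm. 2.3 (i) «`ρ̄_g|_{G_K}` is
irreducible»; [FW21, Thm. 4.41] «`ρ̄_f|G_𝒦` is absolutely irreducible» — on the `ρ̄`-onto locus of the cell's consumers both hold
for every quadratic `K`, the image of `G_K` containing `SL₂(𝔽_p)`), and (iii) «there is a prime `q ∥ M` which is nonsplit in `K`»
(erratum Thm. 2.3 (iii); [FW21, Thm. 4.41] third bullet «there exists `q ∥ N` … which is not split in `𝒦`»). NO residual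
ramification at `q` is asked — it is asked nowhere in the printed «⊂» chain ([FW21 4.41], App. B Cor. 7.21, [CGS25 2.4.5]-type
comparison, [JSW17 Cor. 3.4.2] (irred_K), [Hsi14 Thm. B], Hida theory [Ski16 §2.6], [Cas20 Thm. 2.11]). This discharges the
`TODO(general form)` «(i) as printed» of F4♯ ∕ F4♯†; F4♯† follows from this `Prop` and [Ski20, Lem. 2.8.1] (not claimed here).
NEVER cite this `Prop` as a theorem: take it as an explicit hypothesis; a result using it is conditional on unrefereed claims.
-- TODO(general form): the receptacle in print is `Λ_𝒪^ur = Λ_{R₀} ⊗_{ℤ_p} 𝒪`.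
[claim: Castella2018Erratum, status: under-review]
[claim: FouquetWan2021, status: under-review]
[cite: Skinner2020, Lem. 2.8.1 (footnote 1 of the erratum: (i′) ⟹ (i); shape only, nothing asserted)]
[cite: JetchevSkinnerWan2017, Cor. 3.4.2, proof of Thm. 6.1.6 and §5.1 (the inputs of (2.4) ⇒ (2.5) and the Σ-imprimitive interpolation; shape)]
[cite: Castella2018, Def. 2.2, Thm. 3.1 and (3.1) (p. 9) (the objects `X^Σ_ac`, `L^Σ_p`; shape only, nothing asserted)]
[cite: CastellaHsieh2018, §1 (p. 1) and §7.1 (the self-dual lattice `T ⊂ V_f(r)` with its pairing `T × T → 𝒪(1)`)] -/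
def erratumThm23_charIdeal_sigma_le_of_isTorsion_selfDual_irrK_OPEN : Prop :=
  ∀ {p : ℕ} [Fact p.Prime] (ι : PadicAlgCl p ≃+* ℂ) {M : ℕ} [NeZero M] {k : ℤ}
    (g : CuspForm (CongruenceSubgroup.Gamma0 M) k) (ιg : coeffField g →+* PadicAlgCl p)
    (Δ : OrdinaryNewformDatum g p ιg)
    (K : Type) [Field K] [NumberField K] (𝔭 𝔭bar : HeightOneSpectrum (𝓞 K)) (κ : ZpExtension K p)
    (γ : absoluteGaloisGroup K) [Fact (κ.IsTopGenerator γ)] (S : Finset (HeightOneSpectrum (𝓞 K))),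
    -- "`g ∈ S_k(Γ₀(M))` a `p`-ordinary newform of (even) weight `k ≥ 2` and level `M ≥ 3` with `p ∤ M`"; ADDED: `p > 3` (flag `T23-p`)
    IsNewform0 g → 2 ≤ k → Even k → 3 ≤ M → ¬ p ∣ M → 3 < p →
    -- ONE embedding `ı_p` fixed once (§2, p. 2): the coefficient embedding `ι_g` IS `ι⁻¹` on `ℚ(g) ⊂ ℂ` (flag `T23-compat`), `g` is `ı_p`-ordinary
    (∀ x : coeffField g, ι (ιg x) = (x : ℂ)) →
    ‖ιg ⟨(UpperHalfPlane.qExpansion 1 ⇑g).coeff p, coeff_mem_coeffField g p⟩‖ = 1 →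
    -- `K` imaginary quadratic, Heegner for `M`, `p` split, `𝔭` via `ι`, `𝔭bar ≠ 𝔭` the other prime above `p` (flag `T23-orient`)
    IsImaginaryQuadratic K → (∃ β : ℤ, (4 * M : ℤ) ∣ β ^ 2 - NumberField.discr K) →
    ((Ideal.span {(p : ℤ)}).primesOver (𝓞 K)).ncard = 2 →
    ((p : ℕ) : 𝓞 K) ∈ 𝔭.asIdeal →
    (∀ (w : InfinitePlace K) (x : 𝓞 K), x ∈ 𝔭.asIdeal ↔ ‖ι.symm (w.embedding (x : K))‖ < 1) →
    ((p : ℕ) : 𝓞 K) ∈ 𝔭bar.asIdeal → 𝔭bar ≠ 𝔭 →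
    -- (i) AS PRINTED (erratum Thm. 2.3 (i); [FW21, Thm. 4.41] first bullet): `ρ̄_g|_{G_K}` is irreducible — the reduction
    -- `ρ̄ = ρ mod ϖ` of the datum restricted along the tree's `absGaloisRestrict ℚ K` (as in `Δ.selfDualCofreeRepOver K`);
    -- insensitive to the twist by a power of `ε` (residually a power of `ω`, a character)
    IsSimpleOrder (Subrepresentation
      ((SkinnerUrban2014.residualRep Δ).comp (absGaloisRestrict ℚ K : absoluteGaloisGroup K →* absoluteGaloisGroup ℚ))) →
    -- (iii) AS PRINTED (erratum Thm. 2.3 (iii); [FW21, Thm. 4.41] third bullet): there is a prime `q ∥ M` which is non-split in `K`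
    (∃ q : ℕ, q.Prime ∧ q ∣ M ∧ ¬ q ^ 2 ∣ M ∧ ((Ideal.span {(q : ℤ)}).primesOver (𝓞 K)).ncard ≠ 2) →
    -- (ii) "if `2` is nonsplit in `K`, then `2 ∥ M`"
    (((Ideal.span {(2 : ℤ)}).primesOver (𝓞 K)).ncard ≠ 2 → (2 ∣ M ∧ ¬ 4 ∣ M)) →
    -- (iii)+(iv) every `ℓ ∣ M` non-split in `K`: `ℓ ∥ M` and `π(g)_ℓ` special ⊗ (`ℓ ↦ −ℓ^{k/2−1}`), i.e. `a_ℓ(g) = −ℓ^{k/2−1}`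
    (∀ ℓ : ℕ, ℓ.Prime → ℓ ∣ M → ((Ideal.span {(ℓ : ℤ)}).primesOver (𝓞 K)).ncard ≠ 2 →
      ¬ ℓ ^ 2 ∣ M ∧ (UpperHalfPlane.qExpansion 1 ⇑g).coeff ℓ = -((ℓ : ℂ) ^ (k / 2 - 1).toNat)) →
    -- `Γ` THE anticyclotomic `ℤ_p`-extension; `Σ` finite, away from `p`, containing the primes dividing `M`
    κ.IsAnticyclotomic → (∀ w ∈ S, ((p : ℕ) : 𝓞 K) ∉ w.asIdeal) →
    (∀ w : HeightOneSpectrum (𝓞 K), ((M : ℕ) : 𝓞 K) ∈ w.asIdeal → w ∈ S) →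
    -- the inclusion `b : 𝒪 → 𝓞_{ℂ_p}` (characterised) and a Σ-imprimitive frame `(Ω_K, Ω_p, Q)` of `g` in `𝓞_{ℂ_p}⟦T⟧`
    ∀ (b : padicCoeffIntegers ιg →+* PadicComplexInt p),
      (∀ x, ((b x : PadicComplexInt p) : ℂ_[p]) =
        algebraMap (PadicAlgCl p) ℂ_[p] (padicCoeffIntegers.toPadicAlgCl ιg x)) →
    ∀ (ΩK : ℂ) (Ωp : (PadicComplexInt p)ˣ) (Q : PowerSeries (PadicComplexInt p)), ΩK ≠ 0 →
      IsBDPLFunctionWtSigmaInt ι 𝔭 κ γ g S ΩK ((Ωp : PadicComplexInt p) : ℂ_[p]) Q →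
      ∀ [TopologicalSpace (PowerSeries (padicCoeffIntegers ιg))]
        [ContinuousSMul (PowerSeries (padicCoeffIntegers ιg))
          (BigRepModule (padicCoeffIntegers ιg) p (Cofree Δ.selfDualRep (padicCoeffField ιg)))],
      -- premise (R-f): `X^Σ_ac(A_g)` (SELF-DUAL `A_g`) is `Λ_𝒪`-torsion; conclusion (2.5): `Ch_{Λ_𝒪}(X^Σ_ac(A_g))·𝓞_{ℂ_p}⟦T⟧ ⊆ (Q)`
      Module.IsTorsion (PowerSeries (padicCoeffIntegers ιg)) (XBig κ (Δ.selfDualCofreeRepOver K) 𝔭bar (↑S)) →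
      (XBig.charIdeal κ (Δ.selfDualCofreeRepOver K) 𝔭bar (↑S)).map (PowerSeries.map b) ≤ Ideal.span {Q}

end Literature.NumberTheory.EllipticCurves.Castella2018

end
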